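import Literature.NumberTheory.Rogawski1990.LocalCentralizerTorusMeasureCM      -- ★ p840488 B-p04 (g33): (o3) at `G`-regular points; `isClosed_centralizer_H_local`, `isRegularElt_of_fin_one` currency
import HarnessLib

/-!
# The normalised torus measure on `Z_H(ε_H)` at an `H`-REGULAR, `G`-singular point `ε_H = (A, u) ∈ H_v = U(Φ₂)(L⁺_v) × U(Φ₁)(L⁺_v)`
# (Rogawski 1990 §4.3 (4.3.1) p. 43, §8.2 Prop. 8.2.1 (c); Tits 1979 §3.9) — the (o3′) rider of ★ `LocalCentralizerTorusMeasureCM`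

Topic `NumberTheory/Rogawski1990`; namespace `Literature.NumberTheory.Rogawski1990`.  ONE THEOREM + two private determinant helpers (no definition, no instance, no notation,
no named fact, no `sorry`).  Cell `pub/hodgecm-mathlib` (D-0151), crux H413 = stmt-HodgeConjecture-24833, floor-2 line «N6nsGerm», stub `stub_N6nsS2`: the binders
`(hTc) (ρ) [IsHaarMeasure ρ] [ρ.IsInvInvariant] (hρ : ρ (compactCore ↥Z_H(ε_H)) = 1)` of ★ `exists_nhds_stableOrbitalIntegralRel_eq_of_torus_singular[_inv]` (F0P2-p02 (g8),
p841614 ∕ p841663) at a base point that is `H`-regular but NOT `G`-regular.  ★ p840488's proof uses `IsLocalGRegular γ_H` only to get `IsRegularElt γ_H.1`; here that is the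
hypothesis (the `U(Φ₁)`-coordinate is `1 × 1`, always regular: ★ `isRegularElt_of_fin_one`).  HONEST LABEL: HC_CM is proved only modulo the printed citations until rung 0 closes.

## References
* [Rogawski1990] J. Rogawski, *Automorphic Representations of Unitary Groups in Three Variables*, Ann. of Math. Stud. 123 (1990): §4.3 (4.3.1) p. 43; §8.2 Prop. 8.2.1 (c) p. 113.
* [Tits1979] J. Tits, *Reductive groups over local fields*, Proc. Sympos. Pure Math. 33.1 (1979): §3.9.
-/

set_option autoImplicit false

noncomputable section

open MeasureTheory Measure Set Filter Topology NumberField IsDedekindDomain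
open scoped ENNReal NNReal Matrix MatrixGroups

namespace Literature.NumberTheory.Rogawski1990

open Literature.NumberTheory.Automorphic Literature.NumberTheory.Automorphic.UnitaryGroup

section HRegular

variable (L : Type) [Field L] [NumberField L] [IsCMField L] (v : HeightOneSpectrum (𝓞 ↥(maximalRealSubfield L)))

omit [IsCMField L] in
/-- `Φ₂ = antidiag(1,1)` has unit determinant. [cite: Rogawski1990, §4.9 p. 54] -/
private theorem isUnit_det_antidiagTwo₂ : IsUnit (Matrix.of fun i j : Fin 2 => if i.val + j.val + 1 = 2 then (1 : L) else 0).det := by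
  have h : (Matrix.of fun i j : Fin 2 => if i.val + j.val + 1 = 2 then (1 : L) else 0) = !![0, 1; 1, 0] := by
    ext i j; fin_cases i <;> fin_cases j <;> rfl
  rw [h, Matrix.det_fin_two_of]; norm_num

omit [IsCMField L] in
/-- `Φ₁ = (1)` has unit determinant. [cite: Rogawski1990, §4.9 p. 54] -/
private theorem isUnit_det_antidiagOne₂ : IsUnit (Matrix.of fun i j : Fin 1 => if i.val + j.val + 1 = 1 then (1 : L) else 0).det := by
  rw [Matrix.det_fin_one, Matrix.of_apply]; norm_num

/-- **(o3′) THE NORMALISED TORUS MEASURE ON `Z_H(ε_H)` AT AN `H`-REGULAR POINT** (every finite `v`; `ε_H.1` regular semisimple in `GL₂(E_v)`, no `G`-regularity asked):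
`Z_H(ε_H)` is CLOSED and carries a Haar measure `ρ` which is INVERSION INVARIANT with `ρ (compactCore Z_H(ε_H)) = 1` — the `(hTc, ρ, hρ)` input of the torus–singular junction
★ `exists_nhds_stableOrbitalIntegralRel_eq_of_torus_singular_inv` at `ε_H = (A_{a,b}, a)` (★ p840488's proof with `IsRegularElt ε_H.1` as the hypothesis).
[cite: Rogawski1990, §4.3 (4.3.1) p. 43; §8.2 Prop. 8.2.1 (c) p. 113] [cite: Tits1979, §3.9] -/
theorem exists_isHaarMeasure_isInvInvariant_compactCore_eq_one_of_isRegularElt_fst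
    [MeasurableSpace ((UnitaryGroup.cmDatum L 2 (Matrix.of fun i j : Fin 2 => if i.val + j.val + 1 = 2 then (1 : L) else 0)).Local v ×
      (UnitaryGroup.cmDatum L 1 (Matrix.of fun i j : Fin 1 => if i.val + j.val + 1 = 1 then (1 : L) else 0)).Local v)]
    [BorelSpace ((UnitaryGroup.cmDatum L 2 (Matrix.of fun i j : Fin 2 => if i.val + j.val + 1 = 2 then (1 : L) else 0)).Local v ×
      (UnitaryGroup.cmDatum L 1 (Matrix.of fun i j : Fin 1 => if i.val + j.val + 1 = 1 then (1 : L) else 0)).Local v)]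
    (εH : (UnitaryGroup.cmDatum L 2 (Matrix.of fun i j : Fin 2 => if i.val + j.val + 1 = 2 then (1 : L) else 0)).Local v ×
      (UnitaryGroup.cmDatum L 1 (Matrix.of fun i j : Fin 1 => if i.val + j.val + 1 = 1 then (1 : L) else 0)).Local v)
    (h₂ : IsRegularElt (εH.1.val : GL (Fin 2) (UnitaryGroup.LocalRing L v))) :
    IsClosed ((Subgroup.centralizer ({εH} : Set _) : Subgroup _) : Set
        ((UnitaryGroup.cmDatum L 2 (Matrix.of fun i j : Fin 2 => if i.val + j.val + 1 = 2 then (1 : L) else 0)).Local v ×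
          (UnitaryGroup.cmDatum L 1 (Matrix.of fun i j : Fin 1 => if i.val + j.val + 1 = 1 then (1 : L) else 0)).Local v)) ∧
      ∃ ρ : Measure ↥(Subgroup.centralizer ({εH} : Set _)), ρ.IsHaarMeasure ∧ ρ.IsInvInvariant ∧
        ρ (compactCore ↥(Subgroup.centralizer ({εH} : Set _))) = 1 := by
  refine ⟨isClosed_centralizer_H_local L v εH, ?_⟩
  have h₁ : IsRegularElt (εH.2.val : GL (Fin 1) (UnitaryGroup.LocalRing L v)) := isRegularElt_of_fin_one _
  obtain ⟨γ₂, γ₁⟩ := εH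
  have hΦ₂ := antidiagOne_map_transpose (IsCMField.complexConj L) 2
  have hΦ₁ := antidiagOne_map_transpose (IsCMField.complexConj L) 1
  have f₂ := compactCore_centralizer_local_facts_of_isRegularElt (IsCMField.complexConj L) 2 _ (IsCMField.complexConj_ne_one L) hΦ₂
    (isUnit_det_antidiagTwo₂ L) γ₂ h₂
  have f₁ := compactCore_centralizer_local_facts_of_isRegularElt (IsCMField.complexConj L) 1 _ (IsCMField.complexConj_ne_one L) hΦ₁
    (isUnit_det_antidiagOne₂ L) γ₁ h₁
  refine exists_isHaarMeasure_compactCore_centralizer_prod_eq_one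
    (A := (UnitaryGroup.cmDatum L 2 (Matrix.of fun i j : Fin 2 => if i.val + j.val + 1 = 2 then (1 : L) else 0)).Local v)
    (B := (UnitaryGroup.cmDatum L 1 (Matrix.of fun i j : Fin 1 => if i.val + j.val + 1 = 1 then (1 : L) else 0)).Local v)
    γ₂ γ₁ ?_ ?_ ?_ ?_ ?_ ?_
  · exact f₂.1
  · exact f₁.1
  · exact f₂.2.1
  · exact f₂.2.2
  · exact f₁.2.1
  · exact f₁.2.2

end HRegular

end Literature.NumberTheory.Rogawski1990

end
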